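import Literature.AlgebraicGeometry.Frobenioids.UnitTrivializationPerfectionModelSchema
import Literature.AlgebraicGeometry.Frobenioids.PerfectedDivExists
import Literature.AlgebraicGeometry.Frobenioids.UntrModelHypotheses
import Literature.AlgebraicGeometry.Frobenioids.ArithmeticFrobenioidStandard
import HarnessLib

/-!
# Frobenioids I, Prop. 5.3 for `(C^un-tr)^pf`: the schema `PreFrobenioid.Prop53_untrPf` AT THE CONSTRUCTIONS with
# its binders DISCHARGED (over a base of FSM-type: no input left)

Mochizuki, *The geometry of Frobenioids I: the general theory*, Kyushu J. Math. **62** (2008) 293–400, §5,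
Proposition 5.3 p. 103 l. 16–19 ("the Frobenioid … `(C^un-tr)^pf` is of model type and may be obtained as the model
Frobenioid associated to the divisor monoid … `Φ^pf` … and the rational function monoid … `ℚ · Φ^birat = Φ^birat ⊗_ℤ ℚ
= (Φ^birat)^pf`") [cite: MochizukiFrdI2008, Prop. 5.3 p.103]; Prop. 5.5 (iv) p. 104 (the perfected data
`Φ^pf, B^pf, B^pf → (Φ^gp)^pf`) [cite: MochizukiFrdI2008, Prop. 5.5 (iv) p.104].

PROOF-ONLY (seat abc-iut-L1-d5 gen 4; cell abc-iut, L1 sub-DAG `FrdI-Prop53-Cor54` row P53/L04, binder drop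
step 2).  `UnitTrivializationPerfectionModelSchema.lean` closed the schema modulo two binders BY NAME — the standing
hypotheses of Thm. 5.2 for `(Φ, Φ^birat)` (`ModelFrobenioid.Hypotheses`, row P53/L02d) and a perfected divisor datum
`DivBpf` with `IsPerfectedDiv`.  Both are now produced by the tree: the datum by `exists_isPerfectedDiv`
(`PerfectedDivExists.lean`, `Φ` integral objectwise — automatic for a Frobenioid), the hypotheses by
abc-iut-w5-d137's `PreFrobenioid.untrModel_hypotheses` (input: FSM-surjectivity of `Φ^birat`, row P53/L02d) /
`untrModel_hypotheses_of_isOfFSMType` (no input over a base of FSM-type).  Hence: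

* `PreFrobenioid.exists_untrPf_equiv_untrPfModel'` / `prop53_untrPf_holds'` — the `DivBpf` binder dropped;
* `PreFrobenioid.prop53_untrPf_holds_of_biratFSMSurjective` — modulo row P53/L02d only;
* **`PreFrobenioid.prop53_untrPf_holds_of_isOfFSMType`** — over a base category of FSM-type (every base of §6 and of
  [IUTchI]) the schema `Prop53_untrPf` at THE constructions holds with NO binder beyond `IsFrobenioid F`;
* `arith_prop53_untrPf_holds` — the instance at THE arithmetic Frobenioid `C_{K/F}` of Ex. 6.3 (`K/F` Galois,
  number fields; base `FinSubextCat F K` of FSM-type, abc-iut-L6-t10's `arithFrobenioid_isFrobenioid`): a closed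
  kernel statement with no hypothesis.

No definitions; no statement of the paper is re-typed; nothing here bears on [IUTchIII] Cor. 3.12.
-/

namespace Literature.AlgebraicGeometry.Frobenioids

open CategoryTheory Opposite Function

universe w v u v' u'

namespace PreFrobenioid

variable {D : Type u} [Category.{v} D] {Φ : Dᵒᵖ ⥤ CommMonCat.{w}}
  {C : Type u'} [Category.{v'} C] {F : C ⥤ ElemFrobenioid Φ}

/-- `Φ` is integral objectwise for a Frobenioid `C → F_Φ` (Def. 1.1 (iv): `Φ` divisorial).
[cite: MochizukiFrdI2008, Def. 1.1 (iv) p.21] -/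
theorem isCancelMul_of_isFrobenioid (hF : IsFrobenioid F) (A : Dᵒᵖ) : IsCancelMul (Φ.obj A) :=
  isIntegral_iff_isCancelMul.mp (hF.isPreFrobenioid.isDivisorial (unop A)).isPreDivisorial.isIntegral

/-- **`(C^un-tr)^pf ≌ untrPfModel F` over `D`**, the perfected divisor datum no longer a binder (it exists and is
unique, `exists_isPerfectedDiv` / `isPerfectedDiv_unique`). [cite: MochizukiFrdI2008, Prop. 5.3 p.103] -/
theorem exists_untrPf_equiv_untrPfModel' (hF : IsFrobenioid F)
    (h : ModelFrobenioid.Hypotheses Φ (biratSubfunctor F).toMonoid) :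
    ∃ e : Perfection (isFrobenioid_untr hF) ≌ untrPfModel F,
      Nonempty (e.functor ⋙ ModelFrobenioid.baseFunctor _ _ _ ≅ (Perfection.ops (isFrobenioid_untr hF)).base) := by
  obtain ⟨DivBpf, hDiv⟩ := exists_isPerfectedDiv (biratSubfunctor F).incl (isCancelMul_of_isFrobenioid hF)
  exact exists_untrPf_equiv_untrPfModel hF h DivBpf hDiv

/-- **The schema `Prop53_untrPf` at THE constructions, modulo Thm. 5.2's hypotheses for `(Φ, Φ^birat)` only.**
[cite: MochizukiFrdI2008, Prop. 5.3 p.103] -/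
theorem prop53_untrPf_holds' (hF : IsFrobenioid F) (h : ModelFrobenioid.Hypotheses Φ (biratSubfunctor F).toMonoid) :
    Prop53_untrPf F
      (fun S => ∃ (hS : IsFrobenioid S.toFunctor) (hsq : HasBiratSquares S.toFunctor),
        IsOfModelType S.toFunctor hS hsq)
      (PreFrobenioidData.ofFunctor Φ (untrFunctor hF))
      (PreFrobenioidData.perfection (isFrobenioid_untr hF)) := by
  obtain ⟨DivBpf, hDiv⟩ := exists_isPerfectedDiv (biratSubfunctor F).incl (isCancelMul_of_isFrobenioid hF)
  exact prop53_untrPf_holds hF h DivBpf hDiv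

/-- **The schema `Prop53_untrPf` at THE constructions, modulo row P53/L02d only** (FSM-surjectivity of the
pull-backs of `Φ^birat`, `FrdI.Prop53Sub.BiratFSMSurjective F`; the other clauses of Thm. 5.2's hypotheses are carried
by the pre-Frobenioid structure, abc-iut-w5-d137's `untrModel_hypotheses`). [cite: MochizukiFrdI2008, Prop. 5.3 p.103] -/
theorem prop53_untrPf_holds_of_biratFSMSurjective (hF : IsFrobenioid F)
    (h02d : FrdI.Prop53Sub.BiratFSMSurjective F) :
    Prop53_untrPf F
      (fun S => ∃ (hS : IsFrobenioid S.toFunctor) (hsq : HasBiratSquares S.toFunctor),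
        IsOfModelType S.toFunctor hS hsq)
      (PreFrobenioidData.ofFunctor Φ (untrFunctor hF))
      (PreFrobenioidData.perfection (isFrobenioid_untr hF)) :=
  prop53_untrPf_holds' hF (untrModel_hypotheses F hF.isPreFrobenioid h02d)

/-- **Proposition 5.3 for `(C^un-tr)^pf` over a base of FSM-type, NO binder left**: for every Frobenioid `C → F_Φ`
over a base category `D` of FSM-type, `(C^un-tr)^pf` (THE perfection datum of `C^un-tr`) is a Frobenioid of model
type and is equivalent over `D` to "the model Frobenioid associated to `Φ^pf` and `ℚ · Φ^birat = (Φ^birat)^pf`"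
(`untrPfModel F`) — the schema `Prop53_untrPf` at THE constructions. [cite: MochizukiFrdI2008, Prop. 5.3 p.103] -/
theorem prop53_untrPf_holds_of_isOfFSMType (hF : IsFrobenioid F) (hD : IsOfFSMType D) :
    Prop53_untrPf F
      (fun S => ∃ (hS : IsFrobenioid S.toFunctor) (hsq : HasBiratSquares S.toFunctor),
        IsOfModelType S.toFunctor hS hsq)
      (PreFrobenioidData.ofFunctor Φ (untrFunctor hF))
      (PreFrobenioidData.perfection (isFrobenioid_untr hF)) :=
  prop53_untrPf_holds' hF (untrModel_hypotheses_of_isOfFSMType F hF.isPreFrobenioid hD)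

end PreFrobenioid

/-! ### Instance: THE arithmetic Frobenioid `C_{K/F}` (Ex. 6.3) -/

section Arith

variable (F : Type) [Field F] [NumberField F] (K : Type) [Field K] [Algebra F K] [IsGalois F K]

/-- **Prop. 5.3 for `(C_{K/F}^un-tr)^pf`, no hypothesis**: for THE arithmetic Frobenioid `C_{K/F}` of Ex. 6.3
(`K/F` a Galois extension of number fields), `(C^un-tr)^pf` is a Frobenioid of model type and is equivalent over
`D = FinSubextCat F K` to the model Frobenioid of `(Φ^pf, ℚ · Φ^birat)` — the schema `PreFrobenioid.Prop53_untrPf` at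
THE constructions (`prop53_untrPf_holds_of_isOfFSMType` at `arithFrobenioid_isFrobenioid`, `FinSubextCat.isOfFSMType`).
[cite: MochizukiFrdI2008, Thm. 6.4 (i) p.115] -/
theorem arith_prop53_untrPf_holds :
    PreFrobenioid.Prop53_untrPf
      (ModelFrobenioid.toElem (arithDivisorFunctor F K) (unitsFunctor F K) (divNatTrans F K))
      (fun S => ∃ (hS : PreFrobenioid.IsFrobenioid S.toFunctor) (hsq : PreFrobenioid.HasBiratSquares S.toFunctor),
        PreFrobenioid.IsOfModelType S.toFunctor hS hsq)
      (PreFrobenioidData.ofFunctor _ (PreFrobenioid.untrFunctor (arithFrobenioid_isFrobenioid F K)))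
      (PreFrobenioidData.perfection (PreFrobenioid.isFrobenioid_untr (arithFrobenioid_isFrobenioid F K))) :=
  PreFrobenioid.prop53_untrPf_holds_of_isOfFSMType (arithFrobenioid_isFrobenioid F K) (FinSubextCat.isOfFSMType F K)

end Arith

end Literature.AlgebraicGeometry.Frobenioids
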